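import Summits.QuantumFields.YangMills.Theorems.BalabanUVNodesN11TkOpMeasurable
import Summits.QuantumFields.YangMills.Theorems.BalabanUVNodesN11NoExpansionGeneralStepCoPHOldBranch
import Summits.QuantumFields.YangMills.Theorems.BalabanUVNodesN11NoExpansionGeneralStepCoPHDoor
import Summits.QuantumFields.YangMills.Theorems.BalabanUVNodesN11NoExpansionAllLargeCoP

/-!
# DAG node N11 — THE OLD-BRANCH MEASURABILITY BINDER `hmB` DISCHARGED ALONG THE ALL-LARGE-FIELD DIAGONAL at the door of node00-def-K0a's cured witness:
# the cured residual's `ζ0_j(Y)` is measurable (def-T's `tstep.measW`), the diagonal operand is `exp(−g₀⁻²A((ω 0).1) − E)` (measurable), and 11a's branch operator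
# preserves measurability (`…N11TkOpMeasurable`) — so Theorem 1's diagonal 𝐓-step holds from `Provisos₁₃Core` + `SLaw` + the old-branch BOUND `hCB` ONLY

HEADER — WORK-UNIT METADATA.  Cell `pub-ymgap`, YM-PLAN Track A (HUMAN RULING D-0062), seat `pub-ymgap-dag-n11-d` (g9; R134 fan-out seat N11 [B14], strategy s2),
route `BalabanUVNodes` rev 25, item K1⁷ `StabilityBAtRecordR13SepCoPH` = stmt-QuantumFields-20542 (helper, `--kind proof --supports 20542 --as helper`, count-neutral).
[III] = [Balaban1988Convergent].  Over this seat's `…N11TkOpMeasurable` (generic measurability), p547524 `…GeneralStepCoPHOldBranch`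
(`exists_clause_succ_CoPH_of_Omega_empty_of_sLaw₁₃CoPH_of_oldBranch`), p547792 `…GeneralStepCoPHDoor` (`hA_of_allLarge`, `chiSeqOfRecord_init_eq_one_of_allLarge`), p528220
`…NoExpansionAllLargeCoP` (`sect2Operand_CoP_eq_of_allLarge`, `init_allLarge`), p540862 (`sect2Operand_congr_residual`, `WtOfRecord₁₃H_eq_tkWeightsOfRecordP`), node00-def-K0a's
FILE 17∕18 (`ZrOfRecord₁₃` faces, `stepWeightPinOfRecord₁₃`, `Stage13RParams.ofCured`, `Provisos₁₃Core.ofCured`), node00-def-K0b's `ZtOfRecord`, def-T's `Provisos₁₃Core.tstep`.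

WHY THIS FILE.  Along the all-large-field diagonal every ingredient of the old branch is explicit: the residual serving the history at the door is K0a's
`ZrOfRecord₁₃ θ₀ p` (two-point pin on def-T's resummed step weight, uniform above `K`), whose `ζ0_j(Y)` is measurable by the row `tstep.measW` and whose `quad` is `0`;
def-R's background reads the fine field and the (2.23) action is term-free (this seat's g4∕g7), so the operand is `exp(−g₀⁻²A((ω 0).1) − E)` for every residual, witness
and branch.  With `…N11TkOpMeasurable` the displayed binder `hmB` is therefore a THEOREM on the diagonal (§4), and p547524's old-branch step at the door needs only the
BOUND `hCB` (§5) — the one analytic row left on the whole diagonal, and the located one.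

WHAT THIS FILE PROVES (0 `sorry`, 0 `def`, standard axioms; `N`-generic).  §1 `measurable_ζ0_ZtOfRecord`, `measurable_stepWeightPinOfRecord₁₃`, ★ `measurable_ζ0_ZrOfRecord₁₃`,
`measurable_ζ0_ZrOfRecord₁₃_of_provisosCore`, `measurable_quad_ZrOfRecord₁₃` · §2 `measurable_WtOfRecord₁₃H_ζ`, `measurable_WtOfRecord₁₃H_w` · §3 ★ `measurable_sect2Operand_CoP_of_allLarge`
· §4 ★★ `hmB_of_allLarge` (generic `θ : Stage13HParams` whose residual serving `s′` has measurable `ζ0`, `quad`), ★★ `hmB_door_ofCured_of_allLarge` (door of K0a's cured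
witness, from `θ₀.Provisos₁₃Core` and `1 ≤ M` alone) · §5 ★★★ `exists_clause_succ_CoPH_door_ofCured_of_allLarge_of_hCB` (the diagonal 𝐓-step at the door from
`Provisos₁₃Core` + `SLaw₁₃CoPH … k` + `k < K` + `1 ≤ M` + `hCB` ONLY).

HONEST FRAMING ∕ A6.  Count-neutral kernel bookkeeping; §5 is p547524's old-branch theorem at a NAMED tree term with every binder but `hid` (= the item's antecedent
`SLaw₁₃CoPH … k`) and `hCB` discharged; `hCB` (a sup bound on the old branch, uniform in the field) is inhabited nowhere in the tree and is not expected to be as typed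
(it runs through `margDensity` of the exp-mean-log averaging — located design input: re-type to joint integrability).  Nothing of Bałaban's asserted; sequences with
`Ω_{k+1} ≠ ∅` untouched ([III] §3 ∕ Thm 2 proper); N11 NOT discharged; K1⁷ NOT closed; counts unmoved (typed 28∕28 · discharged 5∕28).  One finite four-torus programme
at fixed `ε = L^{−K}` — NOT ℝ⁴, NOT OS, NOT a mass gap, NOT Clay.
Sources: [III] Theorem p.245, Thm 1 p.262, (1.11) p.248, (2.12) p.256, (2.17)–(2.18) p.257, (2.20)–(2.25) pp.258–259, (3.2)–(3.9) pp.265–266, (3.16)–(3.20) pp.268–269,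
(3.23)–(3.25) p.270, p.267.
-/

noncomputable section

open MeasureTheory
open scoped BigOperators Matrix.Norms.L2Operator

namespace Summit.QuantumFields.YangMills.Theorems.BalabanUVNodesN11DiagonalOldBranchMeasurable

open Literature.MathematicalPhysics.QuantumFieldTheory.Balaban1983to89 T4Continuum Node00 Node00.Tk DagBinding
open B15DeterminingSets
open BalabanUVNodesN11TkOpMeasurable
open BalabanUVNodesN11NoExpansionAllLargeCoP (sect2Operand_CoP_eq_of_allLarge init_allLarge)
open BalabanUVNodesN11NoExpansionDiagonalCoPH (WtOfRecord₁₃H_eq_tkWeightsOfRecordP sect2Operand_congr_residual)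
open BalabanUVNodesN11NoExpansionGeneralStepCoPHDoor (chiSeqOfRecord_init_eq_one_of_allLarge hA_of_allLarge)
open BalabanUVNodesN11NoExpansionGeneralStepCoPHOldBranch (exists_clause_succ_CoPH_of_Omega_empty_of_sLaw₁₃CoPH_of_oldBranch)

variable {F : T4Family} {N : ℕ} [NeZero N]

/-! ## §1  The residuals of record have measurable `ζ0_j(Y)` -/

section Residuals

variable (θ : Stage13Params F N) (p : B12.RunParams)

omit [NeZero N] in
/-- node00-def-K0b's uniform factor is constant in the configuration, hence measurable. [cite: Balaban1988Convergent, p.267 (bookkeeping)] -/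
theorem measurable_ζ0_ZtOfRecord (K j : ℕ) (Y : Set (Site (F.P K) 0)) : Measurable ((ZtOfRecord F N K).ζ0 j Y) :=
  (measurable_const : Measurable fun _ : MultiCfg (F.P K) (SU N) (FluctV N) => ((Nat.card (Set (Site (F.P K) 0)) : ℝ))⁻¹)

variable {θ p}

/-- **node00-def-K0a's generation-`j` pin value is measurable** given the displayed joint measurability of def-T's step weight at the all-large index (row
`tstep.measW`): it reads `((ω j).1, avg_j (ω j).1)`. [cite: Balaban1988Convergent, (3.2)–(3.5) pp.264–265, (3.16) p.268 (bookkeeping)] -/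
theorem measurable_stepWeightPinOfRecord₁₃ (j : ℕ)
    (hmw : Measurable fun z : GaugeField (F.P p.K) (j + 1) (SU N) × GaugeField (F.P p.K) j (SU N) =>
      wOfRecord₉ F N θ.toStage9Params p (gOfRecord₁₃ F N θ p) j (seqAllLargeOfRecord F θ.ν θ.τ9.M (gOfRecord₁₃ F N θ p) p.K (j + 1)) z.2 z.1) :
    Measurable (stepWeightPinOfRecord₁₃ F N θ p j) := by
  have hV : Measurable fun ω : MultiCfg (F.P p.K) (SU N) (FluctV N) => (ω j).1 := measurable_fst.comp (measurable_pi_apply j)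
  have hg : Measurable fun ω : MultiCfg (F.P p.K) (SU N) (FluctV N) => ((avOfRecord F N p.K j).avg (ω j).1, (ω j).1) :=
    ((avOfRecord_measurable F N p.K j).comp hV).prodMk hV
  have h := hmw.comp hg
  exact h

/-- **★ node00-def-K0a's RUN-INDEXED RESIDUAL OF RECORD HAS MEASURABLE `ζ0_j(Y)`** for every `(j, Y)`, given `tstep.measW` at the all-large indices below `K`.
[cite: Balaban1988Convergent, p.267, (3.16)–(3.20) pp.268–269 (bookkeeping)] -/
theorem measurable_ζ0_ZrOfRecord₁₃
    (hmw : ∀ j, j < p.K → Measurable fun z : GaugeField (F.P p.K) (j + 1) (SU N) × GaugeField (F.P p.K) j (SU N) =>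
      wOfRecord₉ F N θ.toStage9Params p (gOfRecord₁₃ F N θ p) j (seqAllLargeOfRecord F θ.ν θ.τ9.M (gOfRecord₁₃ F N θ p) p.K (j + 1)) z.2 z.1)
    (j : ℕ) (Y : Set (Site (F.P p.K) 0)) : Measurable ((ZrOfRecord₁₃ F N θ p).ζ0 j Y) := by
  by_cases hj : j < p.K
  · by_cases hT : Y = Set.univ
    · subst hT
      rw [show (ZrOfRecord₁₃ F N θ p).ζ0 j Set.univ = stepWeightPinOfRecord₁₃ F N θ p j from funext fun ω => ZrOfRecord₁₃_ζ0_univ hj ω]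
      exact measurable_stepWeightPinOfRecord₁₃ j (hmw j hj)
    · by_cases h0 : Y = ∅
      · subst h0
        rw [show (ZrOfRecord₁₃ F N θ p).ζ0 j ∅ = fun ω => 1 - stepWeightPinOfRecord₁₃ F N θ p j ω from funext fun ω => ZrOfRecord₁₃_ζ0_empty hj ω]
        exact measurable_const.sub (measurable_stepWeightPinOfRecord₁₃ j (hmw j hj))
      · rw [show (ZrOfRecord₁₃ F N θ p).ζ0 j Y = fun _ => 0 from funext fun ω => ZrOfRecord₁₃_ζ0_of_ne_of_ne hj hT h0 ω]
        exact measurable_const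
  · rw [show (ZrOfRecord₁₃ F N θ p).ζ0 j Y = (ZtOfRecord F N p.K).ζ0 j Y from funext fun ω => ZrOfRecord₁₃_ζ0_of_le (Nat.not_lt.mp hj) Y ω]
    exact measurable_ζ0_ZtOfRecord p.K j Y

/-- **… keyed on def-T's core provisos** (row `tstep.measW`). [cite: Balaban1988Convergent, (3.2)–(3.9) pp.265–266 (bookkeeping)] -/
theorem measurable_ζ0_ZrOfRecord₁₃_of_provisosCore (h : θ.Provisos₁₃Core F N) (j : ℕ) (Y : Set (Site (F.P p.K) 0)) :
    Measurable ((ZrOfRecord₁₃ F N θ p).ζ0 j Y) :=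
  measurable_ζ0_ZrOfRecord₁₃ (fun j hj => (h.tstep p j hj).measW _) j Y

/-- `quad ≡ 0` of the cured residual is measurable. [cite: Balaban1988Convergent, (3.23) p.270 (bookkeeping)] -/
theorem measurable_quad_ZrOfRecord₁₃ (j : ℕ) (Λ' : Set (Site (F.P p.K) 0)) : Measurable ((ZrOfRecord₁₃ F N θ p).quad j Λ') :=
  (measurable_const : Measurable fun _ : MultiCfg (F.P p.K) (SU N) (FluctV N) => (0 : ℝ))

end Residuals

/-! ## §2  The 𝐓-weights of the v1.7 record are measurable when the history's residual is -/

section Weights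

variable (θ : Stage13HParams F N) (p : B12.RunParams)

/-- **THE 𝐓-WEIGHTS SERVING A HISTORY HAVE MEASURABLE `ζ_j(Y)`** when the residual serving it has. [cite: Balaban1988Convergent, (2.21) p.258, (3.16) p.268 (bookkeeping)] -/
theorem measurable_WtOfRecord₁₃H_ζ {n : ℕ} (s : SeqOfRecord F θ.ν θ.τ9.M (gOfRecord₁₃ F N θ.toStage13Params p) p.K n) (j : ℕ) (Y : Set (Site (F.P p.K) 0))
    (hζ : Measurable ((θ.zhAt p s).ζ0 j Y)) : Measurable ((WtOfRecord₁₃H F N θ p s).ζ j Y) := by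
  rw [WtOfRecord₁₃H_eq_tkWeightsOfRecordP]
  exact measurable_tkWeightsOfRecordP_ζ F N (FluctV N) θ.ν θ.A₁ p _ _ j Y hζ

/-- **… AND MEASURABLE A-WEIGHTS `w_j(Λ′, Y, S)`** when the residual's `quad_j(Λ′)` is (12a's `χA_j` is measurable, `…N11TkOpMeasurable`).
[cite: Balaban1988Convergent, (2.21) p.258, (3.21) p.269, (3.23) p.270 (bookkeeping)] -/
theorem measurable_WtOfRecord₁₃H_w {n : ℕ} (s : SeqOfRecord F θ.ν θ.τ9.M (gOfRecord₁₃ F N θ.toStage13Params p) p.K n) (j : ℕ)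
    (Λ' Y S : Set (Site (F.P p.K) 0)) (hq : Measurable ((θ.zhAt p s).quad j Λ')) : Measurable ((WtOfRecord₁₃H F N θ p s).w j Λ' Y S) := by
  rw [WtOfRecord₁₃H_eq_tkWeightsOfRecordP]
  exact measurable_tkWeightsOfRecordP_w F N (FluctV N) θ.ν θ.A₁ p _ _ j Λ' Y S hq

end Weights

/-! ## §3  The §2 operand along the all-large-field history is measurable (it is `exp(−g₀⁻²A((ω 0).1) − E)`) -/

section Operand

variable (θ : Stage13Params F N) (p : B12.RunParams)

/-- **THE OPERAND `e^{A_n(s)}` AT THE `CoP` BACKGROUND ALONG THE ALL-LARGE-FIELD HISTORY IS MEASURABLE** on the all-scales configuration, for EVERY residual,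
term-value witness, constant and branch: by this seat's closed form (p528220 `sect2Operand_CoP_eq_of_allLarge` + p540862 residual irrelevance) it is
`exp(−g₀⁻²A((ω 0).1) − E)`, and the Wilson action is measurable (`measurable_wilsonAction4_of_regular`). [cite: Balaban1988Convergent, (2.23) p.258, (2.12) p.256, Thm 1 p.262] -/
theorem measurable_sect2Operand_CoP_of_allLarge (hM : 1 ≤ θ.τ9.M) {n : ℕ} (s : SeqOfRecord F θ.ν θ.τ9.M (gOfRecord₁₃ F N θ p) p.K n)
    (hall : ∀ j, 1 ≤ j → j ≤ n → s.Ω j = ∅) (Rz : Sect2.Residual (F.P p.K) (MatA N)) (t : Sect2.TermValues (F.P p.K) (MatA N) (FluctV N) θ.τ9.M) (Ek : ℝ)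
    (S : ℕ → Set (Site (F.P p.K) 0)) :
    Measurable fun ω : MultiCfg (F.P p.K) (SU N) (FluctV N) =>
      sect2Operand F N (FluctV N) p.K (settingOfRecord₁₃ F N θ p) Rz s t Ek (UbgOfRecord₁₃CoP F N θ p n s) (S, fun j => (ω j).2) (fun j => (ω j).1) := by
  have heq : (fun ω : MultiCfg (F.P p.K) (SU N) (FluctV N) =>
      sect2Operand F N (FluctV N) p.K (settingOfRecord₁₃ F N θ p) Rz s t Ek (UbgOfRecord₁₃CoP F N θ p n s) (S, fun j => (ω j).2) (fun j => (ω j).1)) =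
      fun ω => Real.exp (-(1 / (gOfRecord₁₃ F N θ p 0) ^ 2 * wilsonAction4 (ω 0).1) - Ek) := by
    funext ω
    rw [sect2Operand_congr_residual (settingOfRecord₁₃ F N θ p) Rz (θ.Rz p.K) s t Ek (UbgOfRecord₁₃CoP F N θ p n s),
      sect2Operand_CoP_eq_of_allLarge θ p hM s hall t Ek _ ω]
  rw [heq]
  have h0 : Measurable fun ω : MultiCfg (F.P p.K) (SU N) (FluctV N) => (ω 0).1 := measurable_fst.comp (measurable_pi_apply 0)
  have hA : Measurable fun ω : MultiCfg (F.P p.K) (SU N) (FluctV N) => wilsonAction4 (ω 0).1 :=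
    (Missing.measurable_wilsonAction4 (G := SU N) RegularGaugeGroup.measurable_reTr).comp h0
  exact Real.measurable_exp.comp (((measurable_const.mul hA).neg).sub measurable_const)

end Operand

/-! ## §4  ★★ `hmB` along the diagonal: the OLD BRANCH is measurable for every v1.7 parameter whose residual serving `s′` has measurable `ζ0`, `quad` -/

section HmB

variable (θ : Stage13HParams F N) (p : B12.RunParams)

/-- **★★ THE OLD-BRANCH MEASURABILITY BINDER `hmB` OF p547524 HOLDS ALONG THE ALL-LARGE-FIELD DIAGONAL** — for every `θ : Stage13HParams` whose residual serving
the all-large new sequence `s′` has measurable `ζ0_j(Y)` and `quad_j(Λ′)` (every `(j, Y)`, `(j, Λ′)`), every term-value witness, constant, and old branch: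
`U₀ ↦ 𝐓_k(init s′, S)[e^{A_k(init s′)}](U₀)` is measurable (`M ≥ 1`).  Kernel measure theory only: 11a's branch operator preserves measurability
(`measurable_tkBranchOfRecord_baseCfg`), the weights are measurable (§2), the operand is `exp(−g₀⁻²A((ω 0).1) − E)` (§3). [cite: Balaban1988Convergent, (2.18) p.257, (2.20)–(2.23) p.258, (3.24) p.270 (bookkeeping)] -/
theorem hmB_of_allLarge (hM : 1 ≤ θ.τ9.M) {k : ℕ} (s : SeqOfRecord F θ.ν θ.τ9.M (gOfRecord₁₃ F N θ.toStage13Params p) p.K (k + 1))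
    (hall : ∀ j, 1 ≤ j → j ≤ k + 1 → s.Ω j = ∅)
    (hζ : ∀ (j : ℕ) (Y : Set (Site (F.P p.K) 0)), Measurable ((θ.zhAt p s).ζ0 j Y))
    (hq : ∀ (j : ℕ) (Λ' : Set (Site (F.P p.K) 0)), Measurable ((θ.zhAt p s).quad j Λ'))
    (Rz : Sect2.Residual (F.P p.K) (MatA N)) (t : Sect2.TermValues (F.P p.K) (MatA N) (FluctV N) θ.τ9.M) (E₀ : ℝ) (S : ℕ → Set (Site (F.P p.K) 0)) :
    Measurable fun U₀ : GaugeField (F.P p.K) k (SU N) =>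
      tkBranchOfRecord F N (FluctV N) θ.ν θ.τ9.M _ p.K (WtOfRecord₁₃H F N θ p s) s.init S k
        (fun ω => sect2Operand F N (FluctV N) p.K (settingOfRecord₁₃ F N θ.toStage13Params p) Rz s.init t E₀
          (UbgOfRecord₁₃CoP F N θ.toStage13Params p k s.init) (S, fun j => (ω j).2) (fun j => (ω j).1))
        (baseCfg (V := FluctV N) k U₀) :=
  measurable_tkBranchOfRecord_baseCfg F N (FluctV N) θ.ν θ.τ9.M _ p.K (WtOfRecord₁₃H F N θ p s)
    (fun j Y => measurable_WtOfRecord₁₃H_ζ θ p s j Y (hζ j Y)) (fun j Λ' Y S' => measurable_WtOfRecord₁₃H_w θ p s j Λ' Y S' (hq j Λ'))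
    s.init S k (measurable_sect2Operand_CoP_of_allLarge θ.toStage13Params p hM s.init (init_allLarge θ.toStage13Params p s hall) Rz t E₀ S)

/-- **★★ … AT THE DOOR OF node00-def-K0a's CURED WITNESS FAMILY, FROM `θ₀.Provisos₁₃Core` ALONE** (`1 ≤ M`): the residual serving every history is `ZrOfRecord₁₃ θ₀ p`,
whose `ζ0` is measurable by `tstep.measW` and whose `quad` is `0`. [cite: Balaban1988Convergent, (2.18) p.257, (2.20)–(2.23) p.258, (3.16) p.268, (3.24) p.270 (bookkeeping)] -/
theorem hmB_door_ofCured_of_allLarge (θ₀ : Stage13Params F N) (h : θ₀.Provisos₁₃Core F N) (hM : 1 ≤ θ₀.τ9.M) {k : ℕ}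
    (s : SeqOfRecord F θ₀.ν θ₀.τ9.M (gOfRecord₁₃ F N θ₀ p) p.K (k + 1)) (hall : ∀ j, 1 ≤ j → j ≤ k + 1 → s.Ω j = ∅)
    (t : Sect2.TermValues (F.P p.K) (MatA N) (FluctV N) θ₀.τ9.M) (E₀ : ℝ) :
    ∀ S ∈ admSOfRecord F θ₀.ν θ₀.τ9.M (gOfRecord₁₃ F N θ₀ p) p.K k s.init,
      Measurable fun U₀ : GaugeField (F.P p.K) k (SU N) =>
        tkBranchOfRecord F N (FluctV N) θ₀.ν θ₀.τ9.M _ p.K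
          (WtOfRecord₁₃H F N (Stage13HParams.ofHistoryBlind F N (Stage13RParams.ofCured F N θ₀)) p s) s.init S k
          (fun ω => sect2Operand F N (FluctV N) p.K (settingOfRecord₁₃ F N θ₀ p)
            ((Stage13HParams.ofHistoryBlind F N (Stage13RParams.ofCured F N θ₀)).rzAt p s.init) s.init t E₀
            (UbgOfRecord₁₃CoP F N θ₀ p k s.init) (S, fun j => (ω j).2) (fun j => (ω j).1))
          (baseCfg (V := FluctV N) k U₀) := fun S _ =>
  hmB_of_allLarge (Stage13HParams.ofHistoryBlind F N (Stage13RParams.ofCured F N θ₀)) p hM s hall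
    (fun j Y => measurable_ζ0_ZrOfRecord₁₃_of_provisosCore h j Y) (fun j Λ' => measurable_quad_ZrOfRecord₁₃ j Λ') _ t E₀ S

end HmB

/-! ## §5  ★★★ The diagonal 𝐓-step at the door of K0a's cured witness from `Provisos₁₃Core` + `SLaw` + the old-branch BOUND `hCB` only -/

section Door

variable (θ₀ : Stage13Params F N) (p : B12.RunParams)

/-- **★★★ THEOREM 1's INDUCTIVE 𝐓-STEP ALONG THE ALL-LARGE-FIELD DIAGONAL AT THE DOOR OF K0a's CURED WITNESS — `hmB` DISCHARGED.**  From `θ₀.Provisos₁₃Core`,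
`SLaw₁₃CoPH (door θ₀) p k`, `k < K`, `1 ≤ M` and the displayed BOUND of the old branch `hCB` ONLY (p547524's old-branch form at the door: (P) `rfl`, (V) K0a's pin
face, `hq`∕`hqloc` by `quad ≡ 0`, `hA` term-free (p547792 `hA_of_allLarge`), `hmB` by §4), for the all-large new sequence `s′` of length `k+1`: there are `t₀, E′` with
the 𝐓-image clause of `TLaw₁₃CoPH (door θ₀) p k` at `s′`.  The one displayed analytic row left, `hCB`, is the located one (a sup bound through `margDensity`; wants
re-typing to joint integrability). [cite: Balaban1988Convergent, Theorem p.245, Thm 1 p.262, (3.24)–(3.25) p.270, (2.18) p.257, (2.20)–(2.25) pp.258–259, (1.11) p.248] -/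
theorem exists_clause_succ_CoPH_door_ofCured_of_allLarge_of_hCB (h : θ₀.Provisos₁₃Core F N) {k : ℕ} (hk : k < p.K) (hM : 1 ≤ θ₀.τ9.M)
    (hS : SLaw₁₃CoPH F N (Stage13HParams.ofHistoryBlind F N (Stage13RParams.ofCured F N θ₀)) p k)
    (s : SeqOfRecord F θ₀.ν θ₀.τ9.M (gOfRecord₁₃ F N θ₀ p) p.K (k + 1)) (hall : ∀ j, 1 ≤ j → j ≤ k + 1 → s.Ω j = ∅)
    {C : ℝ}
    (hCB : ∀ (t₀ : Sect2.TermValues (F.P p.K) (MatA N) (FluctV N) θ₀.τ9.M) (E₀ : ℝ),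
      ∀ S ∈ admSOfRecord F θ₀.ν θ₀.τ9.M (gOfRecord₁₃ F N θ₀ p) p.K k s.init, ∀ U₀ : GaugeField (F.P p.K) k (SU N),
      |tkBranchOfRecord F N (FluctV N) θ₀.ν θ₀.τ9.M _ p.K
          (WtOfRecord₁₃H F N (Stage13HParams.ofHistoryBlind F N (Stage13RParams.ofCured F N θ₀)) p s) s.init S k
          (fun ω => sect2Operand F N (FluctV N) p.K (settingOfRecord₁₃ F N θ₀ p)
            ((Stage13HParams.ofHistoryBlind F N (Stage13RParams.ofCured F N θ₀)).rzAt p s.init) s.init t₀ E₀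
            (UbgOfRecord₁₃CoP F N θ₀ p k s.init) (S, fun j => (ω j).2) (fun j => (ω j).1))
          (baseCfg (V := FluctV N) k U₀)| ≤ C) :
    ∃ (t₀ : Sect2.TermValues (F.P p.K) (MatA N) (FluctV N) θ₀.τ9.M) (E' : ℝ),
      slotsTOfRecord F N θ₀.ν θ₀.τ9 (EOfRecord₁₃ F N θ₀) (wOfRecord₉ F N θ₀.toStage9Params) θ₀.ppSel p (gOfRecord₁₃ F N θ₀ p) (k + 1) s = 0 ∨
        ∀ᵐ V' ∂fieldMeasure (F.P p.K) (k + 1) (SU N),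
          chiSeqOfRecord F N θ₀.ν θ₀.τ9.M (gOfRecord₁₃ F N θ₀ p) p.K (k + 1) s V' ≠ 0 →
            slotsTOfRecord F N θ₀.ν θ₀.τ9 (EOfRecord₁₃ F N θ₀) (wOfRecord₉ F N θ₀.toStage9Params) θ₀.ppSel p (gOfRecord₁₃ F N θ₀ p) (k + 1) s V' =
              sect2Slot F N (FluctV N) p.K (settingOfRecord₁₃ F N θ₀ p)
                ((Stage13HParams.ofHistoryBlind F N (Stage13RParams.ofCured F N θ₀)).rzAt p s)
                (WtOfRecord₁₃H F N (Stage13HParams.ofHistoryBlind F N (Stage13RParams.ofCured F N θ₀)) p s) s t₀ E'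
                (UbgOfRecord₁₃CoP F N θ₀ p (k + 1) s) V' := by
  refine exists_clause_succ_CoPH_of_Omega_empty_of_sLaw₁₃CoPH_of_oldBranch (Stage13HParams.ofHistoryBlind F N (Stage13RParams.ofCured F N θ₀)) p
    h.ofCured.ofHistoryBlind hk hM hS s (hall (k + 1) (Nat.succ_pos k) le_rfl) (fun j _ ω ω' _ => ?_) (fun _ _ => ⟨rfl, rfl⟩)
    (fun t₀ E₀ => hA_of_allLarge θ₀ p hM s hall _ _ t₀ E₀) (fun V' U₀ => ?_) (fun V' U₀ => ?_)
    (fun t₀ E₀ => hmB_door_ofCured_of_allLarge p θ₀ h hM s hall t₀ E₀) hCB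
  · show (ZrOfRecord₁₃ F N θ₀ p).quad j _ ω = (ZrOfRecord₁₃ F N θ₀ p).quad j _ ω'
    rw [ZrOfRecord₁₃_quad, ZrOfRecord₁₃_quad]
  · show (ZrOfRecord₁₃ F N θ₀ p).ζ0 k Set.univ (pairCfgAt (V := FluctV N) k V' U₀) =
      chiSeqOfRecord F N θ₀.ν θ₀.τ9.M (gOfRecord₁₃ F N θ₀ p) p.K k s.init U₀ *
        wOfRecord₉ F N θ₀.toStage9Params p (gOfRecord₁₃ F N θ₀ p) k s U₀ ((avOfRecord F N p.K k).avg U₀)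
    obtain rfl : s = seqAllLargeOfRecord F θ₀.ν θ₀.τ9.M (gOfRecord₁₃ F N θ₀ p) p.K (k + 1) :=
      BalabanUVNodesN11ResidualPinCompletion.seq_eq_seqAllLargeOfRecord θ₀.ν θ₀.τ9.M _ p.K (k + 1) s hall
    rw [chiSeqOfRecord_init_eq_one_of_allLarge θ₀ p _ hall U₀, one_mul]
    exact ZrOfRecord₁₃_ζ0_univ_pairCfgAt hk V' U₀
  · show (ZrOfRecord₁₃ F N θ₀ p).quad k ∅ (pairCfgAt (V := FluctV N) k V' U₀) = 0
    rw [ZrOfRecord₁₃_quad]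

end Door

end Summit.QuantumFields.YangMills.Theorems.BalabanUVNodesN11DiagonalOldBranchMeasurable

end
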